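import Mathlib
import HarnessLib
import Summits.NavierStokesRegularity.NavierStokesRegularity.Theorems.PoloidalWindowDoorLrcModEntireTwistingTHPlaneOscillationEnvelope

/-!
# Item `LrcModEntire` (stmt-NavierStokesRegularity-20428), skeleton twist_split v6, CLASS road to `stub_twistingTHGerm` —
# (BRANCH), first half: the SIGNED plane-oscillation law holds POINTWISE for the branch object `U = (1−μ)(Θ⁺ − Θ⁻)`

Cell ns-regularity-ideate, seat ns-k2-port-2 g4 (kernel-port lineage; `--supports stmt-NavierStokesRegularity-20428 --as helper`; brick (F5a) of the
LEAD ns-poloidal-K2-p3 g13's successor ask «`planeOscObject_of_branches`», memo OSC-LIOUVILLE-g13 v1.5 §5septies; consumer: this seat's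
`…TwistingTHOscRoadSigned.twistingTHGerm_of_signedPlaneOscObject`).  Setting: a class profile `v` (Type-I, continuous, Oseen-mild, div-free),
poloidal along `e₃`, with a GLOBAL time–height–shear structure of slope `μ(t,z)` (`∂₂v_b = μ(t,y₂)∂_b v₂` on the whole slab, `uncurry μ ∈ C³`
on the open slab `{t<0} × ℝ` — e.g. analytic off flat planes, `…TimeHeightShearNormalForm.analyticAt_planeSlope`), and two BRANCH VALUE functions
`Θ⁺, Θ⁻ : (t,z) ↦ ℝ`, `C²` on the open slab, with `Θ⁻(t,y₂) ≤ v₂(t,y) ≤ Θ⁺(t,y₂)` everywhere (plane majorant / minorant of the vertical velocity)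
and ATTAINED at two points `x⁺, x⁻` of the plane `{y₂ = c}` of the slice `t`.  Then, with `U := (1−μ)(Θ⁺ − Θ⁻)` and `S := Θ⁺ + Θ⁻`:

* `signedLaw_at` — **`U(t,c)·(∂ₜU + ½∂_z(S·U) − ∂_zzU)(t,c) ≤ 0`**, whatever the sign of `1 − μ(t,c)`: for `1−μ > 0` near `(t,c)` the products
  `(1−μ)Θ±` are upper/lower envelopes of the Clebsch weight `W = (1−μ)v₂` touching at `x±`, so port-2 g3's `osc_sub_sup` + `osc_divergence_form`
  give (OSC) for `U ≥ 0`; for `1−μ < 0` the roles of `x⁺, x⁻` swap and (OSC) holds for `−U ≥ 0`; at `μ = 1`, `U = 0`.  This is exactly the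
  hypothesis shape `hsgn` of `…TwistingTHOscSignedLiouville` / `…TwistingTHOscRoadSigned` (via `HasFDerivAt (uncurry U)`, next file);
* `oneSided_law` — the common one-sided statement (local domination hypotheses near the two touching points);
* `exists_timeCutoff`, `exists_localSlope` — a `C³` time reparametrisation equal to the identity near `t` with values in `(−∞,0)`, used to feed the
  slab-only slope `μ` to `osc_sub_sup` (which asks for a globally `C³` slope): `μ′(s,h) := μ(φ(s),h)` agrees with `μ` for `s ≤ t/2`.

WHAT THIS IS NOT: not a claim about Navier–Stokes regularity and not the stub — calculus on the stratum (TH) under the (BRANCH) attainment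
hypotheses (bears_on LADDER-NS N0, item 20428 / crux 19708; both OPEN).  The regularity/size dictionary of `U` (second half) is NOT here.
-/

noncomputable section

-- the summit and its single sub-problem share the name (CONVENTIONS §1), as in every Theorems file
set_option linter.dupNamespace false

namespace Summit.NavierStokesRegularity.NavierStokesRegularity.Theorems.PoloidalWindowDoorLrcModEntireTwistingTHBranchLaw

open Set Function Filter Topology
open scoped RealInnerProductSpace InnerProductSpace
open Literature.Analysis Literature.Analysis.FluidPDE
open Summit.NavierStokesRegularity.NavierStokesRegularity.Theorems.PoloidalWindowDoorLrcModEntireTwistingTHPlaneOscillationEnvelope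

/-! ### A `C³` time reparametrisation and the localised slope -/

/-- **Time cutoff**: for `t < 0` there is a `C³` map `φ : ℝ → ℝ` with `φ(s) = s` for `s ≤ t/2` (a neighbourhood of `t`) and `φ < 0` everywhere. -/
theorem exists_timeCutoff {t : ℝ} (ht : t < 0) :
    ∃ φ : ℝ → ℝ, ContDiff ℝ 3 φ ∧ (∀ s, φ s < 0) ∧ ∀ s, s ≤ t / 2 → φ s = s := by
  set χ : ℝ → ℝ := fun s => Real.smoothTransition ((s - t / 2) / (-t / 4)) with hχ
  have hχC : ContDiff ℝ 3 χ := by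
    have h1 : ContDiff ℝ 3 (fun s : ℝ => (s - t / 2) / (-t / 4)) := (contDiff_id.sub contDiff_const).div_const _
    exact (Real.smoothTransition.contDiff (n := 3)).comp h1
  have hχ0 : ∀ s, 0 ≤ χ s := fun s => Real.smoothTransition.nonneg _
  have hχ1 : ∀ s, χ s ≤ 1 := fun s => Real.smoothTransition.le_one _
  have ht4 : 0 < -t / 4 := by linarith
  refine ⟨fun s => (1 - χ s) * s + χ s * (t / 2), ?_, ?_, ?_⟩
  · exact ((contDiff_const.sub hχC).mul contDiff_id).add (hχC.mul contDiff_const)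
  · intro s
    show (1 - χ s) * s + χ s * (t / 2) < 0
    rcases le_or_gt 0 s with hs | hs
    · -- `s ≥ 0`: the cutoff is saturated, `φ s = t/2`
      have harg : 1 ≤ (s - t / 2) / (-t / 4) := by
        rw [le_div_iff₀ ht4]; linarith
      have h1 : χ s = 1 := Real.smoothTransition.one_of_one_le harg
      rw [h1]; linarith
    · -- `s < 0`: a convex combination of two negative numbers
      have h0 := hχ0 s
      have h1 := hχ1 s
      nlinarith [mul_nonneg (sub_nonneg.2 h1) (neg_nonneg.2 hs.le), mul_nonneg h0 (by linarith : (0:ℝ) ≤ -(t / 2))]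
  · intro s hs
    have harg : (s - t / 2) / (-t / 4) ≤ 0 := div_nonpos_of_nonpos_of_nonneg (by linarith) ht4.le
    have h0 : χ s = 0 := Real.smoothTransition.zero_of_nonpos harg
    show (1 - χ s) * s + χ s * (t / 2) = s
    rw [h0]; ring

/-- **Localised slope**: a slope function `C³` on the open slab `{t<0} × ℝ` agrees, on the time band `s ≤ t/2` (a neighbourhood of `t < 0`), with a
GLOBALLY `C³` function (`μ′(s,h) := μ(φ(s),h)` with the time cutoff `φ`). -/
theorem exists_localSlope {μ : ℝ → ℝ → ℝ} (hμ : ContDiffOn ℝ 3 (uncurry μ) (Iio (0 : ℝ) ×ˢ univ)) {t : ℝ} (ht : t < 0) :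
    ∃ μ' : ℝ → ℝ → ℝ, ContDiff ℝ 3 (uncurry μ') ∧ ∀ s, s ≤ t / 2 → μ' s = μ s := by
  obtain ⟨φ, hφ, hneg, hid⟩ := exists_timeCutoff ht
  refine ⟨fun s h => μ (φ s) h, ?_, fun s hs => by simp only [hid s hs]⟩
  have hF : ContDiff ℝ 3 (fun p : ℝ × ℝ => (φ p.1, p.2)) := (hφ.comp contDiff_fst).prodMk contDiff_snd
  have h := hμ.comp_contDiff hF fun p => mk_mem_prod (hneg p.1) (mem_univ _)
  have e : uncurry (fun s h => μ (φ s) h) = uncurry μ ∘ fun p : ℝ × ℝ => (φ p.1, p.2) := by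
    funext p; rfl
  rw [e]; exact h

/-! ### Slices of slab-smooth functions -/

/-- The open backward slab is a neighbourhood of each of its points. -/
theorem slab_mem_nhds {t : ℝ} (ht : t < 0) (z : ℝ) : Iio (0 : ℝ) ×ˢ (univ : Set ℝ) ∈ 𝓝 (t, z) :=
  prod_mem_nhds (Iio_mem_nhds ht) univ_mem

/-- Height slice of a slab-`Cⁿ` function. -/
theorem contDiff_heightSlice {F : ℝ → ℝ → ℝ} {n : WithTop ℕ∞} (hF : ContDiffOn ℝ n (uncurry F) (Iio (0 : ℝ) ×ˢ univ))
    {t : ℝ} (ht : t < 0) : ContDiff ℝ n (F t) := by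
  have h := hF.comp_contDiff (contDiff_const.prodMk contDiff_id : ContDiff ℝ n fun z : ℝ => (t, z))
    fun z => mk_mem_prod ht (mem_univ _)
  exact h

/-- Time slice of a slab-`Cⁿ` function (`n ≥ 1`) is differentiable at interior times. -/
theorem differentiableAt_timeSlice {F : ℝ → ℝ → ℝ} {n : WithTop ℕ∞} (hF : ContDiffOn ℝ n (uncurry F) (Iio (0 : ℝ) ×ˢ univ))
    (hn : n ≠ 0) {t : ℝ} (ht : t < 0) (z : ℝ) : DifferentiableAt ℝ (fun s => F s z) t := by
  have h1 : DifferentiableAt ℝ (uncurry F) (t, z) := (hF.differentiableOn hn).differentiableAt (slab_mem_nhds ht z)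
  have h2 : DifferentiableAt ℝ (uncurry F ∘ fun s : ℝ => (s, z)) t :=
    h1.comp t ((differentiableAt_id (𝕜 := ℝ)).prodMk (differentiableAt_const z))
  simpa [Function.comp_def] using h2

/-- Continuity of a slab-`Cⁿ` function at interior points, pulled back along `q ↦ (q.1, q.2 2)` from space-time. -/
theorem tendsto_timeHeight {t : ℝ} (x : EuclideanSpace ℝ (Fin 3)) :
    Tendsto (fun q : ℝ × EuclideanSpace ℝ (Fin 3) => (q.1, q.2 2)) (𝓝 (t, x)) (𝓝 (t, x 2)) := by
  have h : Continuous fun q : ℝ × EuclideanSpace ℝ (Fin 3) => (q.1, q.2 2) := by fun_prop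
  exact h.tendsto (t, x)

/-! ### The class setting -/

section Class

variable {C : ℝ} {v : ℝ → EuclideanSpace ℝ (Fin 3) → EuclideanSpace ℝ (Fin 3)}
variable (hrate : HasTypeITimeDecay C v) (hcont : ContinuousOn (uncurry v) (Iio (0 : ℝ) ×ˢ univ))
  (hmild : ∀ s t : ℝ, s < t → t < 0 → ∀ x,
    v t x = UnboundedOperators.heatExtension (v s) (t - s) x - oseenDuhamel 1 s v v t x)
  (hdiv : ∀ t < 0, VectorCalculus.IsDivFree (v t))
  (hpol : ∀ s < 0, ∀ y, ⟪curl (v s) y, EuclideanSpace.single 2 1⟫_ℝ = 0)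
  {μ : ℝ → ℝ → ℝ}
  (hTH : ∀ s < 0, ∀ y : EuclideanSpace ℝ (Fin 3), ∀ b : Fin 3, b ≠ 2 →
    fderiv ℝ (v s) y (EuclideanSpace.single 2 1) b = μ s (y 2) * fderiv ℝ (v s) y (EuclideanSpace.single b 1) 2)
  (hμC : ContDiffOn ℝ 3 (uncurry μ) (Iio (0 : ℝ) ×ˢ univ))

include hrate hcont hmild hdiv hpol hTH hμC

/-- **THE ONE-SIDED LAW.**  Let `Θ₁, Θ₂` be `C²` on the open slab; let `x₁, x₂` lie on the plane `{y₂ = c}` of the slice `t < 0` with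
`v₂(t,x₁) = Θ₁(t,c)`, `v₂(t,x₂) = Θ₂(t,c)`; and suppose the LOCAL DOMINATIONS `(1−μ)v₂ ≤ (1−μ)Θ₁` near `(t,x₁)` and `(1−μ)Θ₂ ≤ (1−μ)v₂`
near `(t,x₂)` (arguments of `μ, Θᵢ` at `(s, y₂)`).  Then with `O := (1−μ)(Θ₁ − Θ₂)`, `S := Θ₁ + Θ₂`:
`∂ₜO(t,c) + ½∂_z(S·O)(t,c) − ∂_zzO(t,c) ≤ 0` (in `deriv` currency). -/
theorem oneSided_law {Θ₁ Θ₂ : ℝ → ℝ → ℝ}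
    (hΘ₁ : ContDiffOn ℝ 2 (uncurry Θ₁) (Iio (0 : ℝ) ×ˢ univ)) (hΘ₂ : ContDiffOn ℝ 2 (uncurry Θ₂) (Iio (0 : ℝ) ×ˢ univ))
    {t : ℝ} (ht : t < 0) {c : ℝ} {x₁ x₂ : EuclideanSpace ℝ (Fin 3)} (hx₁ : x₁ 2 = c) (hx₂ : x₂ 2 = c)
    (hv₁ : v t x₁ 2 = Θ₁ t c) (hv₂ : v t x₂ 2 = Θ₂ t c)
    (hdom₁ : ∀ᶠ q in 𝓝 ((t, x₁) : ℝ × EuclideanSpace ℝ (Fin 3)),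
      (1 - μ q.1 (q.2 2)) * v q.1 q.2 2 ≤ (1 - μ q.1 (q.2 2)) * Θ₁ q.1 (q.2 2))
    (hdom₂ : ∀ᶠ q in 𝓝 ((t, x₂) : ℝ × EuclideanSpace ℝ (Fin 3)),
      (1 - μ q.1 (q.2 2)) * Θ₂ q.1 (q.2 2) ≤ (1 - μ q.1 (q.2 2)) * v q.1 q.2 2) :
    deriv (fun s => (1 - μ s c) * (Θ₁ s c - Θ₂ s c)) t
      + (1 / 2 : ℝ) * deriv (fun z => (Θ₁ t z + Θ₂ t z) * ((1 - μ t z) * (Θ₁ t z - Θ₂ t z))) c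
      - deriv (deriv fun z => (1 - μ t z) * (Θ₁ t z - Θ₂ t z)) c ≤ 0 := by
  -- the localised slope and the neighbourhood `s ≤ t/2` of `t`
  obtain ⟨μ', hμ'C, hμ'eq⟩ := exists_localSlope hμC ht
  have hband : ∀ᶠ s in 𝓝 t, s ≤ t / 2 := Iic_mem_nhds (by linarith)
  have hμ't : μ' t = μ t := hμ'eq t (by linarith)
  -- regularity of the slices
  have hμt3 : ContDiff ℝ 3 (μ t) := contDiff_heightSlice hμC ht
  have hμt2 : ContDiff ℝ 2 (μ t) := hμt3.of_le (by norm_cast)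
  have hΘ₁t : ContDiff ℝ 2 (Θ₁ t) := contDiff_heightSlice hΘ₁ ht
  have hΘ₂t : ContDiff ℝ 2 (Θ₂ t) := contDiff_heightSlice hΘ₂ ht
  have ha : ContDiff ℝ 2 (fun z => 1 - μ t z) := contDiff_const.sub hμt2
  have hMt2 : ContDiff ℝ 2 (fun z => (1 - μ t z) * Θ₁ t z) := ha.mul hΘ₁t
  have hmt2 : ContDiff ℝ 2 (fun z => (1 - μ t z) * Θ₂ t z) := ha.mul hΘ₂t
  have hμs : DifferentiableAt ℝ (fun s => μ s c) t := differentiableAt_timeSlice hμC (by simp) ht c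
  have hΘ₁s : DifferentiableAt ℝ (fun s => Θ₁ s c) t := differentiableAt_timeSlice hΘ₁ (by simp) ht c
  have hΘ₂s : DifferentiableAt ℝ (fun s => Θ₂ s c) t := differentiableAt_timeSlice hΘ₂ (by simp) ht c
  -- ### the touching step `osc_sub_sup` with the localised slope and the envelopes `M = (1−μ)Θ₁`, `m = (1−μ)Θ₂`
  set M : ℝ → ℝ → ℝ := fun s h => (1 - μ s h) * Θ₁ s h with hM
  set m : ℝ → ℝ → ℝ := fun s h => (1 - μ s h) * Θ₂ s h with hm
  have hslope : ∀ y : EuclideanSpace ℝ (Fin 3), y 2 = c →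
      ∀ᶠ z in 𝓝 ((t, y) : ℝ × EuclideanSpace ℝ (Fin 3)), ∀ b : Fin 3, b ≠ 2 →
        fderiv ℝ (v z.1) z.2 (EuclideanSpace.single 2 1) b =
          μ' z.1 (z.2 2) * fderiv ℝ (v z.1) z.2 (EuclideanSpace.single b 1) 2 := by
    intro y _
    have h1 : ∀ᶠ z : ℝ × EuclideanSpace ℝ (Fin 3) in 𝓝 (t, y), z.1 ≤ t / 2 :=
      (continuous_fst.tendsto (t, y)).eventually hband
    have h2 : ∀ᶠ z : ℝ × EuclideanSpace ℝ (Fin 3) in 𝓝 (t, y), z.1 < 0 :=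
      (continuous_fst.tendsto (t, y)).eventually (Iio_mem_nhds ht)
    filter_upwards [h1, h2] with z hz1 hz2 b hb
    rw [hμ'eq z.1 hz1]; exact hTH z.1 hz2 z.2 b hb
  have hMdom : ∀ᶠ q in 𝓝 ((t, x₁) : ℝ × EuclideanSpace ℝ (Fin 3)), (1 - μ' q.1 (q.2 2)) * v q.1 q.2 2 ≤ M q.1 (q.2 2) := by
    have h1 : ∀ᶠ q : ℝ × EuclideanSpace ℝ (Fin 3) in 𝓝 (t, x₁), q.1 ≤ t / 2 :=
      (continuous_fst.tendsto (t, x₁)).eventually hband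
    filter_upwards [h1, hdom₁] with q hq1 hq
    rw [hμ'eq q.1 hq1]; simpa [hM] using hq
  have hmdom : ∀ᶠ q in 𝓝 ((t, x₂) : ℝ × EuclideanSpace ℝ (Fin 3)), m q.1 (q.2 2) ≤ (1 - μ' q.1 (q.2 2)) * v q.1 q.2 2 := by
    have h1 : ∀ᶠ q : ℝ × EuclideanSpace ℝ (Fin 3) in 𝓝 (t, x₂), q.1 ≤ t / 2 :=
      (continuous_fst.tendsto (t, x₂)).eventually hband
    filter_upwards [h1, hdom₂] with q hq1 hq
    rw [hμ'eq q.1 hq1]; simpa [hm] using hq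
  have hMeq : (1 - μ' t (x₁ 2)) * v t x₁ 2 = M t c := by rw [hμ't, hx₁, hv₁]
  have hmeq : (1 - μ' t (x₂ 2)) * v t x₂ 2 = m t c := by rw [hμ't, hx₂, hv₂]
  have hMt : DifferentiableAt ℝ (fun s => M s c) t := (hμs.const_sub 1).mul hΘ₁s
  have hmt : DifferentiableAt ℝ (fun s => m s c) t := (hμs.const_sub 1).mul hΘ₂s
  have hM1 : ∀ᶠ z in 𝓝 c, DifferentiableAt ℝ (M t) z :=
    Eventually.of_forall fun z => (hMt2.differentiable (by norm_num)) z
  have hm1 : ∀ᶠ z in 𝓝 c, DifferentiableAt ℝ (m t) z :=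
    Eventually.of_forall fun z => (hmt2.differentiable (by norm_num)) z
  have hM2 : DifferentiableAt ℝ (deriv (M t)) c := (differentiable_deriv_of_contDiff_two hMt2) c
  have hm2 : DifferentiableAt ℝ (deriv (m t)) c := (differentiable_deriv_of_contDiff_two hmt2) c
  have hsub := osc_sub_sup hrate hcont hmild hdiv hpol hμ'C ht hx₁ hx₂ hslope hMdom hMeq hmdom hmeq hMt hmt hM1 hm1 hM2 hm2
  rw [hμ't, hv₁, hv₂] at hsub
  -- ### the divergence form
  have hda : deriv (fun z => 1 - μ t z) c / 2 = -(deriv (μ t) c / 2) := by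
    rw [deriv_const_sub]; ring
  have hsub' : (deriv (fun s => M s c) t + Θ₁ t c * deriv (fun z => (1 - μ t z) * Θ₁ t z) c
        - deriv (deriv fun z => (1 - μ t z) * Θ₁ t z) c)
      - (deriv (fun s => m s c) t + Θ₂ t c * deriv (fun z => (1 - μ t z) * Θ₂ t z) c
        - deriv (deriv fun z => (1 - μ t z) * Θ₂ t z) c) ≤
      (deriv (fun z => 1 - μ t z) c / 2) * (Θ₁ t c ^ 2 - Θ₂ t c ^ 2) := by
    rw [hda]
    simp only [hM, hm] at hsub
    exact hsub
  have hdiv' := osc_divergence_form (a := fun z => 1 - μ t z) (Θp := Θ₁ t) (Θm := Θ₂ t) ha hΘ₁t hΘ₂t hsub'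
  -- ### rewrite in terms of `O = (1−μ)(Θ₁ − Θ₂)`
  have eO : (fun z => (1 - μ t z) * Θ₁ t z - (1 - μ t z) * Θ₂ t z) = fun z => (1 - μ t z) * (Θ₁ t z - Θ₂ t z) := by
    funext z; ring
  have eSO : (fun z => (Θ₁ t z + Θ₂ t z) * ((1 - μ t z) * Θ₁ t z - (1 - μ t z) * Θ₂ t z)) =
      fun z => (Θ₁ t z + Θ₂ t z) * ((1 - μ t z) * (Θ₁ t z - Θ₂ t z)) := by
    funext z; ring
  have eT : deriv (fun s => M s c) t - deriv (fun s => m s c) t = deriv (fun s => (1 - μ s c) * (Θ₁ s c - Θ₂ s c)) t := by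
    rw [← deriv_fun_sub hMt hmt]
    congr 1; funext s; simp only [hM, hm]; ring
  rw [eO, eSO, eT] at hdiv'
  exact hdiv'

/-- **THE SIGNED LAW AT A POINT for the branch object.**  Let `Θ⁺, Θ⁻` be `C²` on the open slab with `Θ⁻(s,y₂) ≤ v₂(s,y) ≤ Θ⁺(s,y₂)` for all
`s < 0`, `y` (global plane majorant / minorant), attained on the plane `{y₂ = c}` of the slice `t < 0` at `x⁺` resp. `x⁻`.  Then
`U := (1−μ)(Θ⁺ − Θ⁻)`, `S := Θ⁺ + Θ⁻` satisfy `U(t,c)·(∂ₜU + ½∂_z(S·U) − ∂_zzU)(t,c) ≤ 0`. -/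
theorem signedLaw_at {Θp Θm U S : ℝ → ℝ → ℝ}
    (hΘp : ContDiffOn ℝ 2 (uncurry Θp) (Iio (0 : ℝ) ×ˢ univ)) (hΘm : ContDiffOn ℝ 2 (uncurry Θm) (Iio (0 : ℝ) ×ˢ univ))
    (hmax : ∀ s < 0, ∀ y : EuclideanSpace ℝ (Fin 3), v s y 2 ≤ Θp s (y 2))
    (hmin : ∀ s < 0, ∀ y : EuclideanSpace ℝ (Fin 3), Θm s (y 2) ≤ v s y 2)
    (hU : U = fun s h => (1 - μ s h) * (Θp s h - Θm s h)) (hS : S = fun s h => Θp s h + Θm s h)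
    {t : ℝ} (ht : t < 0) {c : ℝ} {xp xm : EuclideanSpace ℝ (Fin 3)} (hxp : xp 2 = c) (hxm : xm 2 = c)
    (hvp : v t xp 2 = Θp t c) (hvm : v t xm 2 = Θm t c) :
    U t c * (deriv (fun s => U s c) t + (1 / 2 : ℝ) * deriv (fun z => S t z * U t z) c - deriv (deriv (U t)) c) ≤ 0 := by
  subst hU hS
  beta_reduce
  -- `Θ⁻(t,c) ≤ Θ⁺(t,c)`
  have hD : Θm t c ≤ Θp t c := by
    have h := hmax t ht xm
    rw [hxm, hvm] at h
    exact h
  -- the sign of `1 − μ` near `(t,c)`, pulled back to space-time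
  have hμcont : ContinuousAt (uncurry μ) (t, c) := (hμC.continuousOn.continuousWithinAt
    (mk_mem_prod ht (mem_univ c))).continuousAt (slab_mem_nhds ht c)
  have hneg_time : ∀ x : EuclideanSpace ℝ (Fin 3), ∀ᶠ q : ℝ × EuclideanSpace ℝ (Fin 3) in 𝓝 (t, x), q.1 < 0 := fun x =>
    (continuous_fst.tendsto (t, x)).eventually (Iio_mem_nhds ht)
  rcases lt_trichotomy 0 (1 - μ t c) with hpos | hzero | hneg
  · -- ### `1 − μ(t,c) > 0`: `(1−μ)Θ⁺` is the upper, `(1−μ)Θ⁻` the lower envelope of `W`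
    have hev : ∀ᶠ p : ℝ × ℝ in 𝓝 (t, c), 0 < 1 - μ p.1 p.2 := by
      have h : ∀ᶠ p : ℝ × ℝ in 𝓝 (t, c), 0 < 1 - uncurry μ p :=
        (continuous_const.continuousAt.sub hμcont).eventually (lt_mem_nhds (by simpa using hpos))
      exact h
    have hdom₁ : ∀ᶠ q in 𝓝 ((t, xp) : ℝ × EuclideanSpace ℝ (Fin 3)),
        (1 - μ q.1 (q.2 2)) * v q.1 q.2 2 ≤ (1 - μ q.1 (q.2 2)) * Θp q.1 (q.2 2) := by
      have h1 := (tendsto_timeHeight (t := t) xp).eventually (by rw [hxp]; exact hev)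
      filter_upwards [h1, hneg_time xp] with q hq hq0
      exact mul_le_mul_of_nonneg_left (hmax q.1 hq0 q.2) hq.le
    have hdom₂ : ∀ᶠ q in 𝓝 ((t, xm) : ℝ × EuclideanSpace ℝ (Fin 3)),
        (1 - μ q.1 (q.2 2)) * Θm q.1 (q.2 2) ≤ (1 - μ q.1 (q.2 2)) * v q.1 q.2 2 := by
      have h1 := (tendsto_timeHeight (t := t) xm).eventually (by rw [hxm]; exact hev)
      filter_upwards [h1, hneg_time xm] with q hq hq0
      exact mul_le_mul_of_nonneg_left (hmin q.1 hq0 q.2) hq.le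
    have hlaw := oneSided_law hrate hcont hmild hdiv hpol hTH hμC hΘp hΘm ht hxp hxm hvp hvm hdom₁ hdom₂
    have hU0 : 0 ≤ (1 - μ t c) * (Θp t c - Θm t c) := mul_nonneg hpos.le (sub_nonneg.2 hD)
    exact mul_nonpos_of_nonneg_of_nonpos hU0 hlaw
  · -- ### `μ(t,c) = 1`: `U(t,c) = 0`
    rw [← hzero, zero_mul, zero_mul]
  · -- ### `1 − μ(t,c) < 0`: the roles swap, (OSC) holds for `−U = (1−μ)(Θ⁻ − Θ⁺)`
    have hev : ∀ᶠ p : ℝ × ℝ in 𝓝 (t, c), 1 - μ p.1 p.2 < 0 := by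
      have h : ∀ᶠ p : ℝ × ℝ in 𝓝 (t, c), 1 - uncurry μ p < 0 :=
        (continuous_const.continuousAt.sub hμcont).eventually (gt_mem_nhds (by simpa using hneg))
      exact h
    have hdom₁ : ∀ᶠ q in 𝓝 ((t, xm) : ℝ × EuclideanSpace ℝ (Fin 3)),
        (1 - μ q.1 (q.2 2)) * v q.1 q.2 2 ≤ (1 - μ q.1 (q.2 2)) * Θm q.1 (q.2 2) := by
      have h1 := (tendsto_timeHeight (t := t) xm).eventually (by rw [hxm]; exact hev)
      filter_upwards [h1, hneg_time xm] with q hq hq0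
      exact mul_le_mul_of_nonpos_left (hmin q.1 hq0 q.2) hq.le
    have hdom₂ : ∀ᶠ q in 𝓝 ((t, xp) : ℝ × EuclideanSpace ℝ (Fin 3)),
        (1 - μ q.1 (q.2 2)) * Θp q.1 (q.2 2) ≤ (1 - μ q.1 (q.2 2)) * v q.1 q.2 2 := by
      have h1 := (tendsto_timeHeight (t := t) xp).eventually (by rw [hxp]; exact hev)
      filter_upwards [h1, hneg_time xp] with q hq hq0
      exact mul_le_mul_of_nonpos_left (hmax q.1 hq0 q.2) hq.le
    have hlaw := oneSided_law hrate hcont hmild hdiv hpol hTH hμC hΘm hΘp ht hxm hxp hvm hvp hdom₁ hdom₂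
    -- every term of the law for `(1−μ)(Θ⁻ − Θ⁺)` is minus the corresponding term for `U`
    have e1 : (fun s => (1 - μ s c) * (Θm s c - Θp s c)) = fun s => -((1 - μ s c) * (Θp s c - Θm s c)) := by
      funext s; ring
    have e2 : (fun z => (Θm t z + Θp t z) * ((1 - μ t z) * (Θm t z - Θp t z))) =
        fun z => -((Θp t z + Θm t z) * ((1 - μ t z) * (Θp t z - Θm t z))) := by
      funext z; ring
    have e3 : (fun z => (1 - μ t z) * (Θm t z - Θp t z)) = fun z => -((1 - μ t z) * (Θp t z - Θm t z)) := by
      funext z; ring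
    have e4 : deriv (fun z => -((1 - μ t z) * (Θp t z - Θm t z))) = fun z => -deriv (fun z => (1 - μ t z) * (Θp t z - Θm t z)) z := by
      funext z; exact deriv.fun_neg
    rw [e1, e2, e3, deriv.fun_neg, deriv.fun_neg, e4, deriv.fun_neg] at hlaw
    have hU0 : (1 - μ t c) * (Θp t c - Θm t c) ≤ 0 := mul_nonpos_of_nonpos_of_nonneg hneg.le (sub_nonneg.2 hD)
    have hlaw' : 0 ≤ deriv (fun s => (1 - μ s c) * (Θp s c - Θm s c)) t
        + (1 / 2 : ℝ) * deriv (fun z => (Θp t z + Θm t z) * ((1 - μ t z) * (Θp t z - Θm t z))) c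
        - deriv (deriv fun z => (1 - μ t z) * (Θp t z - Θm t z)) c := by linarith
    exact mul_nonpos_of_nonpos_of_nonneg hU0 hlaw'

end Class

end Summit.NavierStokesRegularity.NavierStokesRegularity.Theorems.PoloidalWindowDoorLrcModEntireTwistingTHBranchLaw
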